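import Summits.AnomalousDissipation.AnomalousDissipation.Theorems.ImpulseGridAssembly
import Summits.AnomalousDissipation.AnomalousDissipation.Theorems.ImpulseGridGridInjectionIdentity
import Summits.AnomalousDissipation.AnomalousDissipation.Theorems.ImpulseGridBoundedEnergyNoLeakGridStubAbsorbingBallGrid
import Summits.AnomalousDissipation.AnomalousDissipation.Theses.Correlation

/-!
# Route ImpulseGrid (AnomalousDissipation) — the crux `GridSigns` implies `CorrelationPersistence`

Support file for the crux `GridSigns` (item stmt-AnomalousDissipation-1771), line `SketchIdeator2`
(lead c1): the inter-route arrow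
`correlationPersistence_of_gridSigns : ImpulseGrid.GridSigns → Correlation.CorrelationPersistence`
(stmt-1771 ⇒ stmt-0201, "the large-scale half of the zeroth law": a FIXED smooth force and a
vanishing-viscosity Leray–Hopf family with `ν`-uniformly bounded mean energy and a `ν`-uniform
INJECTION FLOOR `⟨(f,uⱼ)⟩ ≥ ε > 0`).

Proof (the first half of the route's Assembly, without the no-leakage clause): for each `j` the
landed grid injection identity (`impulseGrid_gridInjectionIdentity`, item 1774; its sup-energy
hypothesis is automatic at `νⱼ > 0` by the landed absorbing-ball bound `stub_absorbingBallGrid`)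
with `∫ΦΨ|G|² = 0`, no reversal (a) and early relaxation (b) gives
`c·Λ⟨(f,uⱼ)⟩ ≥ η − νⱼ·Λ⟨(uⱼ,Δ(Ψ•G))⟩ ≥ η − νⱼ·K` with `K` uniform in `j`
(`impulseGrid_longTimeAvg_inner_le`, mean energy `≤ E`); along the tail `j ≥ J` this is `≥ η/2`,
and `Λ ≤ limsup` on the bounded Cesàro means of the injection turns it into
`longTimeAvgSup ⟨(f,uⱼ)⟩ ≥ η/(2c) =: ε`. Together with `boundedEnergyGrid_of_gridSigns`
(`Theorems/ImpulseGridGridSignsHierarchy`) this pins the crux between the two routes' open cruxes: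
`GridThesis ⇒ GridSigns ⇒ CorrelationPersistence ∧ BoundedEnergyGrid`. No new definitions.
-/

noncomputable section

-- `Summit.<Summit>.<Problem>` is the tree's mandated summit-side namespace (CONVENTIONS §2); for this
-- single-conjunct summit the two coincide, so the duplicate is deliberate.
set_option linter.dupNamespace false

open MeasureTheory Set Filter Topology
open scoped InnerProductSpace RealInnerProductSpace

namespace Summit.AnomalousDissipation.AnomalousDissipation.Theorems.GridSignsCeilings

open Literature.Analysis
open Literature.Analysis.FluidPDE Literature.Analysis.FluidPDE.Torus
open Literature.Analysis.FunctionSpaces Literature.Analysis.FunctionSpaces.Torus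
open Summit.AnomalousDissipation.AnomalousDissipation.Theses.ImpulseGrid
open Summit.AnomalousDissipation.AnomalousDissipation.Theses.Correlation

/-- **The grid signs imply persistence of the injection**:
`ImpulseGrid.GridSigns → Correlation.CorrelationPersistence` (stmt-1771 ⇒ stmt-0201). With the
grid force `f = Φ•G` and the tail `j ↦ j + J` of the crux's family, `⟨(f,uⱼ)⟩ ≥ η/(2c)` in the
`limsup` sense, at `ν`-uniformly bounded mean energy (grid injection identity + absorbing ball +
`Λ ≤ limsup`; Doering–Foias 2002 §2 bookkeeping). [folklore] -/
theorem correlationPersistence_of_gridSigns : GridSigns → CorrelationPersistence := by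
  rintro ⟨Φ, Ψ, G, c, η, Λ, hΦ, hΨ, hG, hΨinv, hGinv, hG0, hGdiv, hdΨ, hΦΨG, hfs, hfdiv, hfmean,
    hc, hη, ν, u₀, u, hν, hν0, hLH, -, ⟨E, hE⟩, ha, hb⟩
  -- per-`j` sup-energy bounds (absorbing ball at `ν_j > 0`)
  have hsup : ∀ j, ∃ C : ℝ, ∀ t : ℝ, 0 ≤ t → kineticEnergy (u j t) ≤ C := fun j => by
    obtain ⟨C, -, hC⟩ := BoundedEnergyNoLeakGrid.stub_absorbingBallGrid (ν j) (fun x => Φ x • G x)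
      (u₀ j) (u j) (hν j) hfs hfmean (hLH j)
    exact ⟨C, hC⟩
  -- a uniform bound for the viscous pairing `Λ⟨(u_j, Δ(Ψ•G))⟩`
  have hΦ₀ : IsSmooth (fun y => Ψ y • G y) := hΨ.smul' hG
  obtain ⟨K, hK0, hK⟩ :=
    exists_nonneg_forall_norm_le_of_continuous hΦ₀.laplacian.continuous
  obtain ⟨KB, hKBpos, hBle⟩ : ∃ KB : ℝ, 0 < KB ∧ ∀ j, Λ.longTimeAvg (fun t => ∫ x,
      ⟪u j t x, laplacian (fun y => Ψ y • G y) x⟫) ≤ KB := by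
    refine ⟨max (K * (2⁻¹ * (1 + (E + 1)))) 1, lt_of_lt_of_le one_pos (le_max_right _ _),
      fun j => ?_⟩
    obtain ⟨C, hC⟩ := hsup j
    exact (impulseGrid_longTimeAvg_inner_le Λ (hLH j) hΦ₀.laplacian.continuous hK0 hK hC
      (hE j)).trans (le_max_left _ _)
  -- choose the tail: `ν_j · KB ≤ η/2` for `j ≥ J`
  obtain ⟨J, hJ⟩ : ∃ J : ℕ, ∀ j ≥ J, ν j < η / (2 * KB) :=
    eventually_atTop.1 (hν0.eventually (gt_mem_nhds (by positivity)))
  -- the injection floor along the tail, in the `limsup` sense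
  have hfloor : ∀ j, J ≤ j →
      η / (2 * c) ≤ longTimeAvgSup (fun t => ∫ x, ⟪Φ x • G x, u j t x⟫) := by
    intro j hj
    obtain ⟨C, hC⟩ := hsup j
    have hid := (impulseGrid_gridInjectionIdentity Λ (ν j) c Φ Ψ G (u₀ j) (u j) (hν j) hΦ hΨ hG
      hΨinv hGinv hG0 hGdiv hdΨ (hLH j) ⟨C, hC⟩).1
    rw [hΦΨG, sub_zero] at hid
    have h1 : ν j * Λ.longTimeAvg (fun t => ∫ x,
        ⟪u j t x, laplacian (fun y => Ψ y • G y) x⟫) ≤ ν j * KB :=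
      mul_le_mul_of_nonneg_left (hBle j) (hν j).le
    have h2 : ν j * KB ≤ η / 2 := by
      have h := hJ j hj
      rw [lt_div_iff₀ (by positivity)] at h
      linarith
    have h3 : 0 ≤ c * Λ.longTimeAvg (fun t => ∫ x, ⟪G x, u j t x⟫) := mul_nonneg hc.le (ha j)
    have h4 := hb j
    -- so `c · Λ⟨(f, u_j)⟩ ≥ η / 2`
    have h5 : η / 2 ≤ c * Λ.longTimeAvg (fun t => ∫ x, ⟪Φ x • G x, u j t x⟫) := by
      rw [hid]
      linarith
    have h6 : η / (2 * c) ≤ Λ.longTimeAvg (fun t => ∫ x, ⟪Φ x • G x, u j t x⟫) := by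
      rw [div_le_iff₀ (by positivity)]
      linarith
    -- `Λ ≤ limsup` on the bounded Cesàro means of the injection
    refine h6.trans ?_
    obtain ⟨Kf, hKf0, hKf⟩ := exists_nonneg_forall_norm_le_of_continuous hfs.continuous
    have hg : ∀ t : ℝ, 0 < t → |∫ x, ⟪Φ x • G x, u j t x⟫| ≤ Kf * (2⁻¹ * (1 + 2 * C)) := by
      intro t ht
      have h := impulseGrid_abs_integral_inner_le (Φ₀ := fun x => Φ x • G x) (hLH j) hKf0 hKf
        hC ht.le
      simpa only [real_inner_comm] using h
    have hup : ∀ᶠ T in atTop, timeMean (fun t => ∫ x, ⟪Φ x • G x, u j t x⟫) T ≤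
        Kf * (2⁻¹ * (1 + 2 * C)) := by
      filter_upwards [eventually_gt_atTop (0 : ℝ)] with T hT
      exact (abs_le.1 (impulseGrid_abs_timeMean_le hg hT)).2
    have hlo : ∀ᶠ T in atTop, -(Kf * (2⁻¹ * (1 + 2 * C))) ≤
        timeMean (fun t => ∫ x, ⟪Φ x • G x, u j t x⟫) T := by
      filter_upwards [eventually_gt_atTop (0 : ℝ)] with T hT
      exact (abs_le.1 (impulseGrid_abs_timeMean_le hg hT)).1
    exact Λ.le_limsup ⟨_, hup⟩ ⟨_, hlo⟩
  -- `CorrelationPersistence` along the reindexed tail `j ↦ j + J`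
  exact ⟨fun x => Φ x • G x, hfs, hfdiv, hfmean, fun j => ν (j + J), fun j => u₀ (j + J),
    fun j => u (j + J), fun j => hν _, hν0.comp (tendsto_add_atTop_nat J), fun j => hLH _,
    ⟨E, fun j => hE _⟩, η / (2 * c), by positivity, fun j => hfloor (j + J) (Nat.le_add_left J j)⟩

end Summit.AnomalousDissipation.AnomalousDissipation.Theorems.GridSignsCeilings

end
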